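import Summits.QuantumFields.GaugeBoot.Certificates.SparseSupport
import HarnessLib

/-!
# Sparse certificate replay, part 2: rows, residuals and the assembled bound (gauge-boot L4 support)

HONEST FRAMING (cell `pub-gaugeboot`): certified bounds on lattice expectations at stated coupling,
gauge group, dimension and torus size; NOT a mass gap, NOT a continuum limit, NOT a string tension;
NOT Yang–Mills-summit-bearing (barriers `FixedCouplingUltralocality`, `PerturbativeInvisibility`).

Sequel of `Certificates/SparseSupport.lean` (emitter `gb_lean_emit` 0.7 "sparse", FANOUT-PLAN A27):
sparse equality rows zipped with their multipliers (`LR = [(λ_e, rhs_e, row_e)]`, `sget`, `lamDot`,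
`lamRhs`), the per-block trace terms `traceTerm`, the exact residual `resid` and its table re-checked
in variable ranges (`residCheck` / `ResidOK`), the scalar certificate identity `finalCheck`
(`R[0] + Σ_e λ_e rhs_e − Σ_{v ≥ 1} |R[v]| = lower`; unit variable `y_0 = 1`, a-priori bounds
`ρ_v = 1`, no inequality rows, objective constant `0`), and the assembled abstract bound
`objective_bound` through `Literature.Computation.Certificates.JanssonChaykinKeil.lmiForm_bound`
(Jansson–Chaykin–Keil 2007), with the PSD blocks supplied abstractly (duals `Z_k ⪰ 0` and trace
identities `Σ_k tr (Z_k F⁽ᵏ⁾_v) = traceTerm TS v`).  All `[folklore]`.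
-/

namespace Summit.QuantumFields.GaugeBoot.Certificates.Sparse

open Matrix Finset Literature.Computation.Certificates

/-! ## Sparse rows, multipliers, residuals -/

/-- Coefficient of variable `v` in a sparse row `[(w, c), …]` (`0` if absent). [folklore] -/
def sget : List (ℕ × ℚ) → ℕ → ℚ
  | [], _ => 0
  | (w, c) :: rest, v => bif w == v then c else sget rest v

/-- `Σ_e λ_e · row_e[v]` over the zipped list `LR = [(λ_e, rhs_e, row_e)]`. [folklore] -/
def lamDot : List (ℚ × ℚ × List (ℕ × ℚ)) → ℕ → ℚ
  | [], _ => 0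
  | (l, _, row) :: rest, v => l * sget row v + lamDot rest v

/-- `Σ_e λ_e · rhs_e`. [folklore] -/
def lamRhs : List (ℚ × ℚ × List (ℕ × ℚ)) → ℚ
  | [] => 0
  | (l, r, _) :: rest => l * r + lamRhs rest

/-- The default (absent) row of `LR`. [folklore] -/
def dRow : ℚ × ℚ × List (ℕ × ℚ) := (0, 0, [])

/-- `lamDot` as a `Fin ne`-indexed sum. [folklore] -/
theorem lamDot_eq_sum (LR : List (ℚ × ℚ × List (ℕ × ℚ))) (v : ℕ) {ne : ℕ} (h : LR.length ≤ ne) :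
    lamDot LR v = ∑ e : Fin ne, (LR.getD e.val dRow).1 * sget (LR.getD e.val dRow).2.2 v := by
  have hmap : ∀ L : List (ℚ × ℚ × List (ℕ × ℚ)),
      lamDot L v = (L.map fun p => p.1 * sget p.2.2 v).sum := by
    intro L; induction L with
    | nil => rfl
    | cons p rest ih => obtain ⟨l, r, row⟩ := p; simp [lamDot, ih]
  rw [hmap, sum_map_eq_sum_fin (fun p : ℚ × ℚ × List (ℕ × ℚ) => p.1 * sget p.2.2 v) dRow
    (by simp [dRow]) ne LR h]

/-- `lamRhs` as a `Fin ne`-indexed sum. [folklore] -/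
theorem lamRhs_eq_sum (LR : List (ℚ × ℚ × List (ℕ × ℚ))) {ne : ℕ} (h : LR.length ≤ ne) :
    lamRhs LR = ∑ e : Fin ne, (LR.getD e.val dRow).1 * (LR.getD e.val dRow).2.1 := by
  have hmap : ∀ L : List (ℚ × ℚ × List (ℕ × ℚ)), lamRhs L = (L.map fun p => p.1 * p.2.1).sum := by
    intro L; induction L with
    | nil => rfl
    | cons p rest ih => obtain ⟨l, r, row⟩ := p; simp [lamRhs, ih]
  rw [hmap, sum_map_eq_sum_fin (fun p : ℚ × ℚ × List (ℕ × ℚ) => p.1 * p.2.1) dRow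
    (by simp [dRow]) ne LR h]

/-- Block trace terms `Σ_b T_b[v] / 4^{K_b}` for `TS = [(K_b, T_b)]`. [folklore] -/
def traceTerm : List (ℕ × List ℤ) → ℕ → ℚ
  | [], _ => 0
  | (K, T) :: rest, v => (T.getD v 0 : ℚ) / ((4 ^ K : ℕ) : ℚ) + traceTerm rest v

/-- The exact residual `r_v = c_v − Σ_e λ_e row_e[v] − Σ_b T_b[v]/4^{K_b}`. [folklore] -/
def resid (cL : List (ℕ × ℚ)) (LR : List (ℚ × ℚ × List (ℕ × ℚ))) (TS : List (ℕ × List ℤ))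
    (v : ℕ) : ℚ :=
  sget cL v - lamDot LR v - traceTerm TS v

/-- Residual table check for the variables `lo ≤ v < hi`. [folklore] -/
def residCheck (cL : List (ℕ × ℚ)) (LR : List (ℚ × ℚ × List (ℕ × ℚ))) (TS : List (ℕ × List ℤ))
    (R : List ℚ) (lo hi : ℕ) : Bool :=
  natAll (hi - lo) fun t => resid cL LR TS (lo + t) == R.getD (lo + t) 0

/-- What `residCheck` establishes. [folklore] -/
def ResidOK (cL : List (ℕ × ℚ)) (LR : List (ℚ × ℚ × List (ℕ × ℚ))) (TS : List (ℕ × List ℤ))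
    (R : List ℚ) (lo hi : ℕ) : Prop :=
  ∀ v, lo ≤ v → v < hi → resid cL LR TS v = R.getD v 0

/-- Soundness of `residCheck`. [folklore] -/
theorem residOK_of_check {cL : List (ℕ × ℚ)} {LR : List (ℚ × ℚ × List (ℕ × ℚ))}
    {TS : List (ℕ × List ℤ)} {R : List ℚ} {lo hi : ℕ} (h : residCheck cL LR TS R lo hi = true) :
    ResidOK cL LR TS R lo hi := by
  intro v hlo hhi
  have hv := natAll_iff.mp h (v - lo) (by omega)
  rw [show lo + (v - lo) = v by omega] at hv
  exact beq_iff_eq.mp hv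

/-- Concatenating variable ranges. [folklore] -/
theorem ResidOK.append {cL : List (ℕ × ℚ)} {LR : List (ℚ × ℚ × List (ℕ × ℚ))}
    {TS : List (ℕ × List ℤ)} {R : List ℚ} {lo mid hi : ℕ} (h1 : ResidOK cL LR TS R lo mid)
    (h2 : ResidOK cL LR TS R mid hi) : ResidOK cL LR TS R lo hi := fun v hlo hhi =>
  if hm : v < mid then h1 v hlo hm else h2 v (Nat.le_of_not_lt hm) hhi

/-- `Σ_{lo ≤ v < hi} |R[v]|`. [folklore] -/
def absSum (R : List ℚ) (lo hi : ℕ) : ℚ := ∑ t ∈ Finset.range (hi - lo), |R.getD (lo + t) 0|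

/-- The scalar certificate identity `R[0] + Σ_e λ_e rhs_e − Σ_{1 ≤ v < nv} |R[v]| = lower`
(unit variable `0`, a-priori bounds `ρ_v = 1`, objective constant `0`). [folklore] -/
def finalCheck (LR : List (ℚ × ℚ × List (ℕ × ℚ))) (R : List ℚ) (nv : ℕ) (lower : ℚ) : Bool :=
  R.getD 0 0 + lamRhs LR - absSum R 1 nv == lower

/-- The penalty sum over `v ≠ 0` is `absSum R 1 nv`. [folklore] -/
theorem sum_erase_zero_abs (R : List ℚ) (n : ℕ) :
    ∑ v ∈ (Finset.univ : Finset (Fin (n + 1))).erase 0, |R.getD v.val 0| = absSum R 1 (n + 1) := by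
  rw [Finset.sum_erase_eq_sub (Finset.mem_univ _), Fin.sum_univ_succ, absSum]
  simp only [Fin.val_zero, Fin.val_succ, add_sub_cancel_left, Nat.add_sub_cancel]
  rw [← Fin.sum_univ_eq_sum_range (fun t => |R.getD (1 + t) 0|) n]
  exact Finset.sum_congr rfl fun i _ => by rw [Nat.add_comm]

/-! ## The assembled abstract bound -/

/-- **Certified lower bound on the objective from the sparse checks** (abstract conic form: for
every real `y` with `y_0 = 1`, `|y_v| ≤ 1`, the sparse equality rows, and PSD blocks `Σ_v y_v F⁽ᵏ⁾_v`,
the objective `Σ_v c_v y_v` is at least `lower`).  The PSD blocks enter abstractly through their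
duals `Z_k ⪰ 0` and the trace identities `Σ_k tr (Z_k F⁽ᵏ⁾_v) = traceTerm TS v`; the arithmetic is
the residual table `R` (`ResidOK`) and the scalar identity (`finalCheck`).  Soundness theorem:
`JanssonChaykinKeil.lmiForm_bound`. [folklore] -/
theorem objective_bound {nv ne : ℕ} (cL : List (ℕ × ℚ)) (LR : List (ℚ × ℚ × List (ℕ × ℚ)))
    (TS : List (ℕ × List ℤ)) (R : List ℚ) (lower : ℚ) (hLR : LR.length ≤ ne)
    (hres : ResidOK cL LR TS R 0 (nv + 1)) (hfin : finalCheck LR R (nv + 1) lower = true)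
    {K : Type*} [Fintype K] {σ : K → Type*} [∀ k, Fintype (σ k)] [∀ k, DecidableEq (σ k)]
    (F : ∀ k, Fin (nv + 1) → Matrix (σ k) (σ k) ℝ) (Z : ∀ k, Matrix (σ k) (σ k) ℝ)
    (hZ : ∀ k, (Z k).PosSemidef)
    (htr : ∀ v : Fin (nv + 1), ∑ k, trace (Z k * F k v) = ((traceTerm TS v.val : ℚ) : ℝ))
    {y : Fin (nv + 1) → ℝ} (hy0 : y 0 = 1) (hρ : ∀ v : Fin (nv + 1), v ≠ 0 → |y v| ≤ 1)
    (heq : ∀ e : Fin ne, ∑ v : Fin (nv + 1),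
      ((sget (LR.getD e.val dRow).2.2 v.val : ℚ) : ℝ) * y v = (((LR.getD e.val dRow).2.1 : ℚ) : ℝ))
    (hpsd : ∀ k, (∑ v, y v • F k v).PosSemidef) :
    ((lower : ℚ) : ℝ) ≤ ∑ v : Fin (nv + 1), ((sget cL v.val : ℚ) : ℝ) * y v := by
  have h := JanssonChaykinKeil.lmiForm_bound (V := Fin (nv + 1)) (E := Fin ne) (I := Fin 0)
    (K := K) (σ := σ)
    (fun v => ((sget cL v.val : ℚ) : ℝ)) 0 0
    (fun e v => ((sget (LR.getD e.val dRow).2.2 v.val : ℚ) : ℝ))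
    (fun e => (((LR.getD e.val dRow).2.1 : ℚ) : ℝ))
    (fun i => Fin.elim0 i) (fun i => Fin.elim0 i)
    (fun _ => 0) F (fun _ => 1) (fun k => trace (∑ v, y v • F k v))
    (y := y) hy0 hρ heq (fun i => Fin.elim0 i)
    (fun k => by simpa using hpsd k) (fun k => by simp)
    (fun e => (((LR.getD e.val dRow).1 : ℚ) : ℝ)) (fun i => Fin.elim0 i) (fun i => Fin.elim0 i)
    Z (fun _ => 0) (fun k => by simpa using hZ k)
    (fun v => ((R.getD v.val 0 : ℚ) : ℝ))
    (fun v => by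
      rw [← hres v.val (Nat.zero_le _) v.isLt, resid, htr v, lamDot_eq_sum LR v.val hLR]
      push_cast
      simp)
    (((R.getD 0 0 + lamRhs LR : ℚ) : ℝ))
    (by rw [lamRhs_eq_sum LR hLR]; push_cast; simp)
  have hid : ((R.getD 0 0 + lamRhs LR : ℚ) : ℝ) -
      ∑ v ∈ Finset.univ.erase (0 : Fin (nv + 1)), |((R.getD v.val 0 : ℚ) : ℝ)| * 1 =
      ((lower : ℚ) : ℝ) := by
    have hq : R.getD 0 0 + lamRhs LR - absSum R 1 (nv + 1) = lower := beq_iff_eq.mp hfin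
    rw [← sum_erase_zero_abs R nv] at hq
    have := congrArg (Rat.cast : ℚ → ℝ) hq
    push_cast at this
    simpa using this
  rw [hid] at h
  simpa using h

/-! ## Variant with a SHARED row table (appended 2026-08-21, emitter 0.7.1)

For certificate families whose problems share the equality rows (e.g. the upper/lower ends of one
window row, which differ only in the objective), the rows `RW = [(rhs_e, row_e)]` live in ONE module
and each certificate carries only its multipliers `LM = [λ_e]`; a lattice binding then discharges
the row hypotheses once per row table. -/

/-- `Σ_e λ_e · row_e[v]` with multipliers and rows in separate lists (stops at the shorter). [folklore] -/
def lamDot₂ : List ℚ → List (ℚ × List (ℕ × ℚ)) → ℕ → ℚ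
  | l :: ls, rw :: rs, v => l * sget rw.2 v + lamDot₂ ls rs v
  | _, _, _ => 0

/-- `Σ_e λ_e · rhs_e` with multipliers and rows in separate lists. [folklore] -/
def lamRhs₂ : List ℚ → List (ℚ × List (ℕ × ℚ)) → ℚ
  | l :: ls, rw :: rs => l * rw.1 + lamRhs₂ ls rs
  | _, _ => 0

/-- The default (absent) entry of a shared row table. [folklore] -/
def dRow₂ : ℚ × List (ℕ × ℚ) := (0, [])

/-- `lamDot₂` as a `Fin ne`-indexed sum. [folklore] -/
theorem lamDot₂_eq_sum (v : ℕ) : ∀ (ne : ℕ) (LM : List ℚ) (RW : List (ℚ × List (ℕ × ℚ))),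
    LM.length ≤ ne →
      lamDot₂ LM RW v = ∑ e : Fin ne, LM.getD e.val 0 * sget (RW.getD e.val dRow₂).2 v
  | 0, LM, RW, h => by
      have hL : LM = [] := List.eq_nil_of_length_eq_zero (Nat.le_zero.mp h)
      subst hL; cases RW <;> simp [lamDot₂]
  | _ + 1, [], RW, _ => by cases RW <;> simp [lamDot₂]
  | _ + 1, l :: ls, [], _ => by simp [lamDot₂, dRow₂, sget]
  | ne + 1, l :: ls, rw :: rs, h => by
      rw [lamDot₂, Fin.sum_univ_succ]
      simp only [Fin.val_zero, Fin.val_succ, List.getD_cons_zero, List.getD_cons_succ]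
      rw [lamDot₂_eq_sum v ne ls rs (by simpa using h)]

/-- `lamRhs₂` as a `Fin ne`-indexed sum. [folklore] -/
theorem lamRhs₂_eq_sum : ∀ (ne : ℕ) (LM : List ℚ) (RW : List (ℚ × List (ℕ × ℚ))), LM.length ≤ ne →
    lamRhs₂ LM RW = ∑ e : Fin ne, LM.getD e.val 0 * (RW.getD e.val dRow₂).1
  | 0, LM, RW, h => by
      have hL : LM = [] := List.eq_nil_of_length_eq_zero (Nat.le_zero.mp h)
      subst hL; cases RW <;> simp [lamRhs₂]
  | _ + 1, [], RW, _ => by cases RW <;> simp [lamRhs₂]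
  | _ + 1, l :: ls, [], _ => by simp [lamRhs₂, dRow₂]
  | ne + 1, l :: ls, rw :: rs, h => by
      rw [lamRhs₂, Fin.sum_univ_succ]
      simp only [Fin.val_zero, Fin.val_succ, List.getD_cons_zero, List.getD_cons_succ]
      rw [lamRhs₂_eq_sum ne ls rs (by simpa using h)]

/-- The exact residual with a shared row table. [folklore] -/
def resid₂ (cL : List (ℕ × ℚ)) (LM : List ℚ) (RW : List (ℚ × List (ℕ × ℚ))) (TS : List (ℕ × List ℤ))
    (v : ℕ) : ℚ :=
  sget cL v - lamDot₂ LM RW v - traceTerm TS v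

/-- Residual table check (shared rows) for the variables `lo ≤ v < hi`. [folklore] -/
def residCheck₂ (cL : List (ℕ × ℚ)) (LM : List ℚ) (RW : List (ℚ × List (ℕ × ℚ)))
    (TS : List (ℕ × List ℤ)) (R : List ℚ) (lo hi : ℕ) : Bool :=
  natAll (hi - lo) fun t => resid₂ cL LM RW TS (lo + t) == R.getD (lo + t) 0

/-- What `residCheck₂` establishes. [folklore] -/
def ResidOK₂ (cL : List (ℕ × ℚ)) (LM : List ℚ) (RW : List (ℚ × List (ℕ × ℚ)))
    (TS : List (ℕ × List ℤ)) (R : List ℚ) (lo hi : ℕ) : Prop :=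
  ∀ v, lo ≤ v → v < hi → resid₂ cL LM RW TS v = R.getD v 0

/-- Soundness of `residCheck₂`. [folklore] -/
theorem residOK₂_of_check {cL : List (ℕ × ℚ)} {LM : List ℚ} {RW : List (ℚ × List (ℕ × ℚ))}
    {TS : List (ℕ × List ℤ)} {R : List ℚ} {lo hi : ℕ}
    (h : residCheck₂ cL LM RW TS R lo hi = true) : ResidOK₂ cL LM RW TS R lo hi := by
  intro v hlo hhi
  have hv := natAll_iff.mp h (v - lo) (by omega)
  rw [show lo + (v - lo) = v by omega] at hv
  exact beq_iff_eq.mp hv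

/-- Concatenating variable ranges. [folklore] -/
theorem ResidOK₂.append {cL : List (ℕ × ℚ)} {LM : List ℚ} {RW : List (ℚ × List (ℕ × ℚ))}
    {TS : List (ℕ × List ℤ)} {R : List ℚ} {lo mid hi : ℕ} (h1 : ResidOK₂ cL LM RW TS R lo mid)
    (h2 : ResidOK₂ cL LM RW TS R mid hi) : ResidOK₂ cL LM RW TS R lo hi := fun v hlo hhi =>
  if hm : v < mid then h1 v hlo hm else h2 v (Nat.le_of_not_lt hm) hhi

/-- The scalar certificate identity with a shared row table. [folklore] -/
def finalCheck₂ (LM : List ℚ) (RW : List (ℚ × List (ℕ × ℚ))) (R : List ℚ) (nv : ℕ) (lower : ℚ) :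
    Bool :=
  R.getD 0 0 + lamRhs₂ LM RW - absSum R 1 nv == lower

/-- **Certified lower bound on the objective from the sparse checks, shared-row-table form**
(same statement and proof as `objective_bound`, with `rowE e v = sget (RW[e]).2 v`,
`rhs e = (RW[e]).1`, `λ e = LM[e]`). [folklore] -/
theorem objective_bound₂ {nv ne : ℕ} (cL : List (ℕ × ℚ)) (LM : List ℚ)
    (RW : List (ℚ × List (ℕ × ℚ))) (TS : List (ℕ × List ℤ)) (R : List ℚ) (lower : ℚ)
    (hLM : LM.length ≤ ne) (hres : ResidOK₂ cL LM RW TS R 0 (nv + 1))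
    (hfin : finalCheck₂ LM RW R (nv + 1) lower = true)
    {K : Type*} [Fintype K] {σ : K → Type*} [∀ k, Fintype (σ k)] [∀ k, DecidableEq (σ k)]
    (F : ∀ k, Fin (nv + 1) → Matrix (σ k) (σ k) ℝ) (Z : ∀ k, Matrix (σ k) (σ k) ℝ)
    (hZ : ∀ k, (Z k).PosSemidef)
    (htr : ∀ v : Fin (nv + 1), ∑ k, trace (Z k * F k v) = ((traceTerm TS v.val : ℚ) : ℝ))
    {y : Fin (nv + 1) → ℝ} (hy0 : y 0 = 1) (hρ : ∀ v : Fin (nv + 1), v ≠ 0 → |y v| ≤ 1)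
    (heq : ∀ e : Fin ne, ∑ v : Fin (nv + 1),
      ((sget (RW.getD e.val dRow₂).2 v.val : ℚ) : ℝ) * y v = (((RW.getD e.val dRow₂).1 : ℚ) : ℝ))
    (hpsd : ∀ k, (∑ v, y v • F k v).PosSemidef) :
    ((lower : ℚ) : ℝ) ≤ ∑ v : Fin (nv + 1), ((sget cL v.val : ℚ) : ℝ) * y v := by
  have h := JanssonChaykinKeil.lmiForm_bound (V := Fin (nv + 1)) (E := Fin ne) (I := Fin 0)
    (K := K) (σ := σ)
    (fun v => ((sget cL v.val : ℚ) : ℝ)) 0 0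
    (fun e v => ((sget (RW.getD e.val dRow₂).2 v.val : ℚ) : ℝ))
    (fun e => (((RW.getD e.val dRow₂).1 : ℚ) : ℝ))
    (fun i => Fin.elim0 i) (fun i => Fin.elim0 i)
    (fun _ => 0) F (fun _ => 1) (fun k => trace (∑ v, y v • F k v))
    (y := y) hy0 hρ heq (fun i => Fin.elim0 i)
    (fun k => by simpa using hpsd k) (fun k => by simp)
    (fun e => ((LM.getD e.val 0 : ℚ) : ℝ)) (fun i => Fin.elim0 i) (fun i => Fin.elim0 i)
    Z (fun _ => 0) (fun k => by simpa using hZ k)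
    (fun v => ((R.getD v.val 0 : ℚ) : ℝ))
    (fun v => by
      rw [← hres v.val (Nat.zero_le _) v.isLt, resid₂, htr v, lamDot₂_eq_sum v.val ne LM RW hLM]
      push_cast
      simp)
    (((R.getD 0 0 + lamRhs₂ LM RW : ℚ) : ℝ))
    (by rw [lamRhs₂_eq_sum ne LM RW hLM]; push_cast; simp)
  have hid : ((R.getD 0 0 + lamRhs₂ LM RW : ℚ) : ℝ) -
      ∑ v ∈ Finset.univ.erase (0 : Fin (nv + 1)), |((R.getD v.val 0 : ℚ) : ℝ)| * 1 =
      ((lower : ℚ) : ℝ) := by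
    have hq : R.getD 0 0 + lamRhs₂ LM RW - absSum R 1 (nv + 1) = lower := beq_iff_eq.mp hfin
    rw [← sum_erase_zero_abs R nv] at hq
    have := congrArg (Rat.cast : ℚ → ℝ) hq
    push_cast at this
    simpa using this
  rw [hid] at h
  simpa using h

end Summit.QuantumFields.GaugeBoot.Certificates.Sparse
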